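import Mathlib
import Summits.CriticalPhenomena.CardyFormulaZ2.Theorems.CardySelfRefinementGradientComparabilityStubWindowAtRhoZero
import Summits.CriticalPhenomena.CardyFormulaZ2.Theorems.CardySelfRefinementGradientComparabilityKernelsDictionary
import HarnessLib

/-!
# Kesten's window on the slice `ρ = 0`: the stub `stub_sliceKesten` from four-arm stability and pivotal ⇄ four-arm comparability

Crux `stmt-CriticalPhenomena-10269`
(`Summit.CriticalPhenomena.CardyFormulaZ2.Theses.CardySelfRefinement.GradientComparability`),
line `monotone-product-coordinates`, stub `stub_sliceKesten` (Kesten's near-critical stability of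
the non-axial pivotal sum of the localised joint crossing event `Aloc` across the level window
`{c : μ_{k,c}(Aloc) ∈ [vlo, vhi]}` of the `k`-periodic inhomogeneous Bernoulli bond model
`μ_{k,c}` on `ℤ²` — axial edges at `½`, the others at `c` — mesh-uniformly; vocabulary
`ax Aloc window edgeOf P Dc …` from `CardySelfRefinementDefs`, slice dictionary from
`…StubWindowAtRhoZero`).

This file is the ASSEMBLY of the printed proof (Kesten 1987, (4.5) with Lemma 8; Werner 2009,
Lecture 6, Lemma 6.2 "`Σ_x P_p(x pivotal) ≍ n² π̂_p(n)` uniformly for `n ≤ L(p)`" combined with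
Lemma 6.3 "`π̂_p(n) ≍ π̂_{1/2}(n)` for `n ≤ L(p)`"; Nolin 2008, Thm. 27 with the proof of Prop. 34)
transcribed to the slice model and to quad families: the stub follows from

* `(STAB)` **four-arm stability across the level window** — for `c, c'` in the level window the
  alternating four-arm probabilities `μ_{k,c}(fourArmTwoClustersAt x r R)` (cluster form of
  `FourArmGarbanShift`) agree up to a mesh-uniform factor at all scales `R ≤ δ/η`
  (Kesten's Lemma 8 / Nolin's Thm. 27 (`j = 4`) / Duminil-Copin–Manolescu–Tassion 2021, Thm. 1.2
  with Remark 2.3, for the slice model), and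
* `(PIV)` **pivotal ⇄ four-arm comparability at one parameter** — for `c` in the level window
  the non-axial pivotal sum of `Aloc` is comparable, up to constants depending on the family and
  the levels but not on the mesh, to `η⁻² · μ_{k,c}(fourArmTwoClustersAt x r R)` for a reference
  annulus of outer scale `R ≤ δ/η` chosen per mesh (Werner's Lemma 6.2 / Kesten's (4.5) for quad
  families: arm separation, RSW gluing, boundary three-arm bounds — all AT the parameter `c`),

by multiplying the constants (`stub_sliceKesten_of_fourArmStability_of_pivotalComparability`,
the registered helper; `Λ = max C_F 0 · max C 0 / c_F`).  Also recorded: the level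
`c ↦ μ_{k,c}(Aloc)` is the route's `P_η(0, c)` (`sliceLevel_eq_P`) and is monotone
(`sliceLevel_mono`), so the level window is an interval; and the corollary for the original stub
`stub_windowAtRhoZero` (`windowAtRhoZero_of_fourArmStability_of_pivotalComparability`, through the
landed reduction `stub_windowAtRhoZero_of_sliceStability`).  `(STAB)` and `(PIV)` are the two
items the blueprint `sliceKesten_blueprint.md` files for the planner; nothing near-critical is
proved here.
-/

noncomputable section

namespace Summit.CriticalPhenomena.CardyFormulaZ2.Theorems.CardySelfRefinement

open scoped Topology
open Filter Set MeasureTheory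
open Literature.Probability.LatticeModels Literature.Probability.Percolation
open Literature.Probability.Percolation.QuadCrossing
open Summit.CriticalPhenomena.CardyFormulaZ2.Theses.CardySelfRefinement

/-! ## The level on the slice is the route's `P_η(0,·)`; the level window is an interval -/

/-- For a slice law `μ` (bound by the dictionary hypothesis of the stub), the level
`μ_{k,c}(Aloc)` is the route's joint crossing probability `P_η(0, c)`. -/
theorem sliceLevel_eq_P (k : ℕ) (μ : ℝ → Measure (BondConfig (Site 2)))
    (hμ : ∀ c, μ c = (prodBernoulli fun e : Site 2 × Fin 2 =>
      if ax k e then half else Set.projIcc (0 : ℝ) 1 zero_le_one c).map edgeConfig)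
    (m : ℕ) (F : Fin m → Quad (Set.univ : Set ℂ)) (η c : ℝ) :
    (μ c).real (Aloc m F η) = P k m F η 0 c := by
  rw [hμ, ← M_zero_eq_map_edgeConfig, P_eq_real_Aloc]

/-- The level `c ↦ μ_{k,c}(Aloc)` of a slice law is non-decreasing in `c` (for `η ≠ 0`): the
slice model is stochastically increasing in `c` and `Aloc` is an increasing finite cylinder
(`P_mono_c` through `sliceLevel_eq_P`).  Hence the level window `{c : μ_{k,c}(Aloc) ∈ [vlo,vhi]}`
is an interval. -/
theorem sliceLevel_mono (k : ℕ) (μ : ℝ → Measure (BondConfig (Site 2)))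
    (hμ : ∀ c, μ c = (prodBernoulli fun e : Site 2 × Fin 2 =>
      if ax k e then half else Set.projIcc (0 : ℝ) 1 zero_le_one c).map edgeConfig)
    (m : ℕ) (F : Fin m → Quad (Set.univ : Set ℂ)) {η : ℝ} (hη : η ≠ 0) {c c' : ℝ} (hcc' : c ≤ c') :
    (μ c).real (Aloc m F η) ≤ (μ c').real (Aloc m F η) := by
  rw [sliceLevel_eq_P k μ hμ, sliceLevel_eq_P k μ hμ]
  exact P_mono_c k m F hη 0 hcc'

/-- Between two points of the level window every parameter is in the level window. -/
theorem sliceLevel_mem_Icc_of_mem_Icc (k : ℕ) (μ : ℝ → Measure (BondConfig (Site 2)))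
    (hμ : ∀ c, μ c = (prodBernoulli fun e : Site 2 × Fin 2 =>
      if ax k e then half else Set.projIcc (0 : ℝ) 1 zero_le_one c).map edgeConfig)
    (m : ℕ) (F : Fin m → Quad (Set.univ : Set ℂ)) {η : ℝ} (hη : η ≠ 0) {vlo vhi c c' s : ℝ}
    (hc : (μ c).real (Aloc m F η) ∈ Set.Icc vlo vhi) (hc' : (μ c').real (Aloc m F η) ∈ Set.Icc vlo vhi)
    (hs : s ∈ Set.Icc c c') : (μ s).real (Aloc m F η) ∈ Set.Icc vlo vhi :=
  ⟨hc.1.trans (sliceLevel_mono k μ hμ m F hη hs.1), (sliceLevel_mono k μ hμ m F hη hs.2).trans hc'.2⟩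

/-! ## The assembly -/

/-- **`stub_windowAtRhoZero` from `(STAB)` and `(PIV)`** (corollary of the assembly below through
the landed reduction `stub_windowAtRhoZero_of_sliceStability`): Kesten's window stability of
`∂cP(0,·)` across the level band, mesh-uniformly. -/
theorem windowAtRhoZero_of_fourArmStability_of_pivotalComparability
    (hSTAB : ∀ k : ℕ, k = 2 ∨ k = 3 → ∀ μ : ℝ → Measure (BondConfig (Site 2)),
      (∀ c, μ c = (prodBernoulli fun e : Site 2 × Fin 2 =>
        if ax k e then half else Set.projIcc (0 : ℝ) 1 zero_le_one c).map edgeConfig) →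
      ∀ (m : ℕ) (F : Fin m → Quad (Set.univ : Set ℂ)), 0 < m →
        ∀ vlo vhi : ℝ, 0 < vlo → vlo < vhi → vhi < 1 →
          ∃ C δ η₁ : ℝ, 0 < δ ∧ 0 < η₁ ∧ ∀ η ∈ Set.Ioo 0 η₁,
            ∀ c ∈ Set.Icc (0 : ℝ) 1, ∀ c' ∈ Set.Icc (0 : ℝ) 1,
              (μ c).real (Aloc m F η) ∈ Set.Icc vlo vhi → (μ c').real (Aloc m F η) ∈ Set.Icc vlo vhi →
                ∀ (x : Site 2) (r R : ℕ), 1 ≤ r → r ≤ R → (R : ℝ) ≤ δ / η →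
                  (μ c).real (fourArmTwoClustersAt x r R) ≤ C * (μ c').real (fourArmTwoClustersAt x r R))
    (hPIV : ∀ k : ℕ, k = 2 ∨ k = 3 → ∀ μ : ℝ → Measure (BondConfig (Site 2)),
      (∀ c, μ c = (prodBernoulli fun e : Site 2 × Fin 2 =>
        if ax k e then half else Set.projIcc (0 : ℝ) 1 zero_le_one c).map edgeConfig) →
      ∀ (m : ℕ) (F : Fin m → Quad (Set.univ : Set ℂ)), 0 < m →
        ∀ vlo vhi : ℝ, 0 < vlo → vlo < vhi → vhi < 1 → ∀ δ : ℝ, 0 < δ →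
          ∃ cF CF η₁ : ℝ, 0 < cF ∧ 0 < η₁ ∧ ∀ η ∈ Set.Ioo 0 η₁,
            ∃ (x : Site 2) (r R : ℕ), 1 ≤ r ∧ r ≤ R ∧ (R : ℝ) ≤ δ / η ∧
              ∀ W : Finset (Sym2 (Site 2)),
                (∀ e, e ∈ W ↔ e ∈ window m F η ∧
                  ∃ (v : Site 2) (d : Fin 2), e = edgeOf (v, d) ∧ ¬ ax k (v, d)) →
                ∀ c ∈ Set.Icc (0 : ℝ) 1, (μ c).real (Aloc m F η) ∈ Set.Icc vlo vhi →
                  cF * ((1 / η) ^ 2 * (μ c).real (fourArmTwoClustersAt x r R)) ≤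
                      ∑ e ∈ W, (μ c).real {ω | IsPivotal (Aloc m F η) e ω} ∧
                    ∑ e ∈ W, (μ c).real {ω | IsPivotal (Aloc m F η) e ω} ≤
                      CF * ((1 / η) ^ 2 * (μ c).real (fourArmTwoClustersAt x r R)))
    (hASM : (∀ k : ℕ, k = 2 ∨ k = 3 → ∀ μ : ℝ → Measure (BondConfig (Site 2)),
      (∀ c, μ c = (prodBernoulli fun e : Site 2 × Fin 2 =>
        if ax k e then half else Set.projIcc (0 : ℝ) 1 zero_le_one c).map edgeConfig) →
      ∀ (m : ℕ) (F : Fin m → Quad (Set.univ : Set ℂ)), 0 < m →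
        ∀ vlo vhi : ℝ, 0 < vlo → vlo < vhi → vhi < 1 →
          ∃ C δ η₁ : ℝ, 0 < δ ∧ 0 < η₁ ∧ ∀ η ∈ Set.Ioo 0 η₁,
            ∀ c ∈ Set.Icc (0 : ℝ) 1, ∀ c' ∈ Set.Icc (0 : ℝ) 1,
              (μ c).real (Aloc m F η) ∈ Set.Icc vlo vhi → (μ c').real (Aloc m F η) ∈ Set.Icc vlo vhi →
                ∀ (x : Site 2) (r R : ℕ), 1 ≤ r → r ≤ R → (R : ℝ) ≤ δ / η →
                  (μ c).real (fourArmTwoClustersAt x r R) ≤ C * (μ c').real (fourArmTwoClustersAt x r R)) →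
      (∀ k : ℕ, k = 2 ∨ k = 3 → ∀ μ : ℝ → Measure (BondConfig (Site 2)),
      (∀ c, μ c = (prodBernoulli fun e : Site 2 × Fin 2 =>
        if ax k e then half else Set.projIcc (0 : ℝ) 1 zero_le_one c).map edgeConfig) →
      ∀ (m : ℕ) (F : Fin m → Quad (Set.univ : Set ℂ)), 0 < m →
        ∀ vlo vhi : ℝ, 0 < vlo → vlo < vhi → vhi < 1 → ∀ δ : ℝ, 0 < δ →
          ∃ cF CF η₁ : ℝ, 0 < cF ∧ 0 < η₁ ∧ ∀ η ∈ Set.Ioo 0 η₁,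
            ∃ (x : Site 2) (r R : ℕ), 1 ≤ r ∧ r ≤ R ∧ (R : ℝ) ≤ δ / η ∧
              ∀ W : Finset (Sym2 (Site 2)),
                (∀ e, e ∈ W ↔ e ∈ window m F η ∧
                  ∃ (v : Site 2) (d : Fin 2), e = edgeOf (v, d) ∧ ¬ ax k (v, d)) →
                ∀ c ∈ Set.Icc (0 : ℝ) 1, (μ c).real (Aloc m F η) ∈ Set.Icc vlo vhi →
                  cF * ((1 / η) ^ 2 * (μ c).real (fourArmTwoClustersAt x r R)) ≤
                      ∑ e ∈ W, (μ c).real {ω | IsPivotal (Aloc m F η) e ω} ∧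
                    ∑ e ∈ W, (μ c).real {ω | IsPivotal (Aloc m F η) e ω} ≤
                      CF * ((1 / η) ^ 2 * (μ c).real (fourArmTwoClustersAt x r R))) →
      ∀ k : ℕ, k = 2 ∨ k = 3 → ∀ μ : ℝ → Measure (BondConfig (Site 2)),
        (∀ c, μ c = (prodBernoulli fun e : Site 2 × Fin 2 =>
          if ax k e then half else Set.projIcc (0 : ℝ) 1 zero_le_one c).map edgeConfig) →
        ∀ (m : ℕ) (F : Fin m → Quad (Set.univ : Set ℂ)), 0 < m →
          ∀ vlo vhi : ℝ, 0 < vlo → vlo < vhi → vhi < 1 →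
            ∃ Λ η₁ : ℝ, 0 < η₁ ∧ ∀ η ∈ Set.Ioo 0 η₁, ∀ W : Finset (Sym2 (Site 2)),
              (∀ e, e ∈ W ↔ e ∈ window m F η ∧
                ∃ (v : Site 2) (d : Fin 2), e = edgeOf (v, d) ∧ ¬ ax k (v, d)) →
              ∀ c ∈ Set.Icc (0 : ℝ) 1, ∀ c' ∈ Set.Icc (0 : ℝ) 1,
                (μ c).real (Aloc m F η) ∈ Set.Icc vlo vhi → (μ c').real (Aloc m F η) ∈ Set.Icc vlo vhi →
                  ∑ e ∈ W, (μ c).real {ω | IsPivotal (Aloc m F η) e ω} ≤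
                    Λ * ∑ e ∈ W, (μ c').real {ω | IsPivotal (Aloc m F η) e ω}) :
    ∀ k : ℕ, k = 2 ∨ k = 3 → ∀ (m : ℕ) (F : Fin m → Quad (Set.univ : Set ℂ)), 0 < m →
      ∀ vlo vhi : ℝ, 0 < vlo → vlo < vhi → vhi < 1 →
        ∃ Λ η₁ : ℝ, 0 < η₁ ∧ ∀ η ∈ Set.Ioo 0 η₁, ∀ c ∈ Set.Icc (0 : ℝ) 1, ∀ c' ∈ Set.Icc (0 : ℝ) 1,
          P k m F η 0 c ∈ Set.Icc vlo vhi → P k m F η 0 c' ∈ Set.Icc vlo vhi →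
            Dc k m F η (0, c) ≤ Λ * Dc k m F η (0, c') :=
  stub_windowAtRhoZero_of_sliceStability (hASM hSTAB hPIV)

/-- **`stub_sliceKesten` from `(STAB)` four-arm stability across the level window and `(PIV)`
pivotal ⇄ four-arm comparability at each window parameter** (Kesten 1987, (4.5) with Lemma 8;
Werner 2009, Lecture 6, Lemma 6.2 combined with Lemma 6.3; Nolin 2008, Thm. 27 and the proof of
Prop. 34 — multiply the constants): with the reference annulus `(x, r, R)`, `R ≤ δ/η`, of `(PIV)`
at mesh `η` and `c, c'` in the level window,
`Σ_W μ_c(piv) ≤ C_F η⁻² π₄^{(c)} ≤ C_F C η⁻² π₄^{(c')} ≤ (C_F C / c_F) Σ_W μ_{c'}(piv)`. -/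
theorem stub_sliceKesten_of_fourArmStability_of_pivotalComparability :
    (∀ k : ℕ, k = 2 ∨ k = 3 → ∀ μ : ℝ → Measure (BondConfig (Site 2)),
      (∀ c, μ c = (prodBernoulli fun e : Site 2 × Fin 2 =>
        if ax k e then half else Set.projIcc (0 : ℝ) 1 zero_le_one c).map edgeConfig) →
      ∀ (m : ℕ) (F : Fin m → Quad (Set.univ : Set ℂ)), 0 < m →
        ∀ vlo vhi : ℝ, 0 < vlo → vlo < vhi → vhi < 1 →
          ∃ C δ η₁ : ℝ, 0 < δ ∧ 0 < η₁ ∧ ∀ η ∈ Set.Ioo 0 η₁,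
            ∀ c ∈ Set.Icc (0 : ℝ) 1, ∀ c' ∈ Set.Icc (0 : ℝ) 1,
              (μ c).real (Aloc m F η) ∈ Set.Icc vlo vhi → (μ c').real (Aloc m F η) ∈ Set.Icc vlo vhi →
                ∀ (x : Site 2) (r R : ℕ), 1 ≤ r → r ≤ R → (R : ℝ) ≤ δ / η →
                  (μ c).real (fourArmTwoClustersAt x r R) ≤ C * (μ c').real (fourArmTwoClustersAt x r R)) →
    (∀ k : ℕ, k = 2 ∨ k = 3 → ∀ μ : ℝ → Measure (BondConfig (Site 2)),
      (∀ c, μ c = (prodBernoulli fun e : Site 2 × Fin 2 =>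
        if ax k e then half else Set.projIcc (0 : ℝ) 1 zero_le_one c).map edgeConfig) →
      ∀ (m : ℕ) (F : Fin m → Quad (Set.univ : Set ℂ)), 0 < m →
        ∀ vlo vhi : ℝ, 0 < vlo → vlo < vhi → vhi < 1 → ∀ δ : ℝ, 0 < δ →
          ∃ cF CF η₁ : ℝ, 0 < cF ∧ 0 < η₁ ∧ ∀ η ∈ Set.Ioo 0 η₁,
            ∃ (x : Site 2) (r R : ℕ), 1 ≤ r ∧ r ≤ R ∧ (R : ℝ) ≤ δ / η ∧
              ∀ W : Finset (Sym2 (Site 2)),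
                (∀ e, e ∈ W ↔ e ∈ window m F η ∧
                  ∃ (v : Site 2) (d : Fin 2), e = edgeOf (v, d) ∧ ¬ ax k (v, d)) →
                ∀ c ∈ Set.Icc (0 : ℝ) 1, (μ c).real (Aloc m F η) ∈ Set.Icc vlo vhi →
                  cF * ((1 / η) ^ 2 * (μ c).real (fourArmTwoClustersAt x r R)) ≤
                      ∑ e ∈ W, (μ c).real {ω | IsPivotal (Aloc m F η) e ω} ∧
                    ∑ e ∈ W, (μ c).real {ω | IsPivotal (Aloc m F η) e ω} ≤
                      CF * ((1 / η) ^ 2 * (μ c).real (fourArmTwoClustersAt x r R))) →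
    ∀ k : ℕ, k = 2 ∨ k = 3 → ∀ μ : ℝ → Measure (BondConfig (Site 2)),
      (∀ c, μ c = (prodBernoulli fun e : Site 2 × Fin 2 =>
        if ax k e then half else Set.projIcc (0 : ℝ) 1 zero_le_one c).map edgeConfig) →
      ∀ (m : ℕ) (F : Fin m → Quad (Set.univ : Set ℂ)), 0 < m →
        ∀ vlo vhi : ℝ, 0 < vlo → vlo < vhi → vhi < 1 →
          ∃ Λ η₁ : ℝ, 0 < η₁ ∧ ∀ η ∈ Set.Ioo 0 η₁, ∀ W : Finset (Sym2 (Site 2)),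
            (∀ e, e ∈ W ↔ e ∈ window m F η ∧
              ∃ (v : Site 2) (d : Fin 2), e = edgeOf (v, d) ∧ ¬ ax k (v, d)) →
            ∀ c ∈ Set.Icc (0 : ℝ) 1, ∀ c' ∈ Set.Icc (0 : ℝ) 1,
              (μ c).real (Aloc m F η) ∈ Set.Icc vlo vhi → (μ c').real (Aloc m F η) ∈ Set.Icc vlo vhi →
                ∑ e ∈ W, (μ c).real {ω | IsPivotal (Aloc m F η) e ω} ≤
                  Λ * ∑ e ∈ W, (μ c').real {ω | IsPivotal (Aloc m F η) e ω} := by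
  intro hSTAB hPIV k hk μ hμ m F hm vlo vhi hvlo hvv hvhi
  obtain ⟨C, δ, η₁, hδ, hη₁, hS⟩ := hSTAB k hk μ hμ m F hm vlo vhi hvlo hvv hvhi
  obtain ⟨cF, CF, η₂, hcF, hη₂, hP⟩ := hPIV k hk μ hμ m F hm vlo vhi hvlo hvv hvhi δ hδ
  refine ⟨max CF 0 * max C 0 / cF, min η₁ η₂, lt_min hη₁ hη₂, fun η hη W hW c hc c' hc' hl hl' => ?_⟩
  have hη1 : η ∈ Set.Ioo 0 η₁ := ⟨hη.1, hη.2.trans_le (min_le_left _ _)⟩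
  have hη2 : η ∈ Set.Ioo 0 η₂ := ⟨hη.1, hη.2.trans_le (min_le_right _ _)⟩
  obtain ⟨x, r, R, hr, hrR, hR, hPη⟩ := hP η hη2
  obtain ⟨-, hup⟩ := hPη W hW c hc hl
  obtain ⟨hlo, -⟩ := hPη W hW c' hc' hl'
  have hstab := hS η hη1 c hc c' hc' hl hl' x r R hr hrR hR
  set X : ℝ := (1 / η) ^ 2 * (μ c).real (fourArmTwoClustersAt x r R) with hX
  set X' : ℝ := (1 / η) ^ 2 * (μ c').real (fourArmTwoClustersAt x r R) with hX'
  set S' : ℝ := ∑ e ∈ W, (μ c').real {ω | IsPivotal (Aloc m F η) e ω} with hS'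
  have hN : 0 ≤ (1 / η) ^ 2 := sq_nonneg _
  have hX0 : 0 ≤ X := mul_nonneg hN measureReal_nonneg
  have hX'0 : 0 ≤ X' := mul_nonneg hN measureReal_nonneg
  have hπ'0 : 0 ≤ (μ c').real (fourArmTwoClustersAt x r R) := measureReal_nonneg
  -- `X ≤ max C 0 · X'`
  have hXX' : X ≤ max C 0 * X' := by
    have h1 : (μ c).real (fourArmTwoClustersAt x r R) ≤ max C 0 * (μ c').real (fourArmTwoClustersAt x r R) :=
      hstab.trans (mul_le_mul_of_nonneg_right (le_max_left _ _) hπ'0)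
    calc X = (1 / η) ^ 2 * (μ c).real (fourArmTwoClustersAt x r R) := rfl
      _ ≤ (1 / η) ^ 2 * (max C 0 * (μ c').real (fourArmTwoClustersAt x r R)) :=
          mul_le_mul_of_nonneg_left h1 hN
      _ = max C 0 * X' := by rw [hX']; ring
  -- `c_F X' ≤ S'`, hence `X' ≤ S' / c_F`
  have hX'S : X' ≤ S' / cF := by
    rw [le_div_iff₀ hcF, mul_comm]
    exact hlo
  calc ∑ e ∈ W, (μ c).real {ω | IsPivotal (Aloc m F η) e ω} ≤ CF * X := hup
    _ ≤ max CF 0 * X := mul_le_mul_of_nonneg_right (le_max_left _ _) hX0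
    _ ≤ max CF 0 * (max C 0 * X') := mul_le_mul_of_nonneg_left hXX' (le_max_right _ _)
    _ ≤ max CF 0 * (max C 0 * (S' / cF)) :=
        mul_le_mul_of_nonneg_left (mul_le_mul_of_nonneg_left hX'S (le_max_right _ _)) (le_max_right _ _)
    _ = max CF 0 * max C 0 / cF * S' := by ring

end Summit.CriticalPhenomena.CardyFormulaZ2.Theorems.CardySelfRefinement

end
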